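import Literature.Analysis.FluidPDE.KNSSLiouvillePlanarHolds
import Literature.Analysis.FluidPDE.KNSSThm52Assembly
import Literature.Analysis.FluidPDE.AncientMildWeak
import Literature.Analysis.FluidPDE.VorticityEquation
import Literature.Analysis.FluidPDE.VectorCalculus
import Literature.Analysis.FluidPDE.PoincareHomotopyOperatorL2
import HarnessLib

/-!
# Stub `stub_noStretchData` of the line `Ideator2Sketch` (card `flux-surface-persistence`)
# (crux `IsobaricLinesLiouville`, stmt-NavierStokesRegularity-11741, route `IsobarTomography`)

The Navier–Stokes half of hull (E) (two stretch-free directions). For a bounded ancient mild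
solution `v` (`ν = 1`, duality form), classical on `(-∞, 0)`, and a fixed vector `e` with
`ω·∇⟪v, e⟫ ≡ 0` (`ω = curl v`), the component `θ = ⟪ω, e⟫` is in the class of KNSS 2009
Lemma 2.1 (`KNSS2009_lemma21_halfball`) with a bounded measurable drift, and every slice of `θ`
is the divergence of a bounded `C¹` field:

* §4 regularity of bounded ancient weak solutions (`KNSS2009_regularity_boundedWeak_ancient_holds`,
  applied to `v` through `IsBoundedAncientMildSolution.isBoundedWeakNSSolutionOn`) furnishes a
  smooth representative `U` with `v(t) = U(t) + b(t)` a.e., all derivatives of `U(t)` bounded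
  uniformly in `t < 0`, time-Lipschitz derivatives of order `≥ 1`, and the integrated vorticity
  equation for `curl U` with drift `U + b`;
* continuity in `x` (both `v(t)` and `U(t) + b(t)` are continuous) and in `t` (joint smoothness
  of `v`, time-Lipschitz bounds for `U`) upgrade the a.e. identity to `curl v(t) = curl U(t)` for
  every `t < 0` (`noStretch_curl_eq`), whence the bounds on `θ`, `Dθ`, `Δθ`
  (`noStretch_family_bounds`); joint continuity of `Dθ`, `Δθ` and `C²` slices come from the
  joint smoothness of `v` on `(-∞, 0) × ℝ³`;
* dotting the integrated vorticity equation with `e`, the stretching integrand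
  `⟪DU ω, e⟫ = ⟪Dv ω, e⟫ = ω·∇⟪v, e⟫` vanishes at a.e. time (`noStretch_equation`), leaving
  `θ(t) − θ(s) = ∫ₛᵗ (Δθ − Dθ[U + b]) dτ`;
* `div (v × e) = ⟪e, curl v⟫ − ⟪v, curl e⟫ = ⟪curl v, e⟫` (`divergence_cross_holds`) with
  `‖v × e‖ ≤ ‖v‖ ‖e‖ ≤ M ‖e‖` (`norm_cross_le`, `noStretch_div_rep`).
-/

-- the summit and its single problem share the name (D-0017 nested layout)
set_option linter.dupNamespace false

noncomputable section

namespace Summit.NavierStokesRegularity.NavierStokesRegularity.Theorems.IsobaricLinesLiouville.FluxSurfacePersistence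

open MeasureTheory Set Function Filter
open scoped RealInnerProductSpace InnerProductSpace Laplacian ContDiff Topology
open Literature.Analysis.FluidPDE

/-! ## Slice calculus for `θ = ⟪curl V, e⟫` -/

/-- `D⟪curl V, e⟫(y) w = ⟪D(curl V)(y) w, e⟫` for `V ∈ C²`. -/
theorem noStretch_fderiv_inner_curl {V : EuclideanSpace ℝ (Fin 3) → EuclideanSpace ℝ (Fin 3)}
    (hV : ContDiff ℝ 2 V) (e y w : EuclideanSpace ℝ (Fin 3)) :
    fderiv ℝ (fun z => ⟪curl V z, e⟫_ℝ) y w = ⟪fderiv ℝ (curl V) y w, e⟫_ℝ := by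
  have hc : ContDiff ℝ 1 (curl V) := contDiff_curl (n := 1) (by exact_mod_cast hV)
  have hd : DifferentiableAt ℝ (curl V) y := (hc.differentiable one_ne_zero) y
  rw [fderiv_inner_apply ℝ hd (differentiableAt_const e), fderiv_const_apply]
  simp

/-- `Δ⟪curl V, e⟫(y) = ⟪Δ(curl V)(y), e⟫` for `V ∈ C³` (the Laplacian commutes with the fixed
linear functional `⟪e, ·⟫`, Mathlib's `ContDiffAt.laplacian_CLM_comp_left`). -/
theorem noStretch_laplacian_inner_curl {V : EuclideanSpace ℝ (Fin 3) → EuclideanSpace ℝ (Fin 3)}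
    (hV : ContDiff ℝ 3 V) (e y : EuclideanSpace ℝ (Fin 3)) :
    (Δ (fun z => ⟪curl V z, e⟫_ℝ)) y = ⟪(Δ (curl V)) y, e⟫_ℝ := by
  have hc : ContDiff ℝ 2 (curl V) := contDiff_curl (n := 2) (by exact_mod_cast hV)
  have heq : (fun z => ⟪curl V z, e⟫_ℝ) = (innerSL ℝ e) ∘ curl V := by
    funext z
    rw [Function.comp_apply, innerSL_apply_apply, real_inner_comm]
  rw [heq, ContDiffAt.laplacian_CLM_comp_left hc.contDiffAt, Function.comp_apply,
    innerSL_apply_apply, real_inner_comm]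

/-- The stretching term dotted with `e`: `⟪DV(y) ω, e⟫ = ⟪ω, ∇⟪V, e⟫(y)⟫` with `ω = curl V y`. -/
theorem noStretch_inner_stretch_eq {V : EuclideanSpace ℝ (Fin 3) → EuclideanSpace ℝ (Fin 3)}
    {y : EuclideanSpace ℝ (Fin 3)} (hV : DifferentiableAt ℝ V y) (e : EuclideanSpace ℝ (Fin 3)) :
    ⟪fderiv ℝ V y (curl V y), e⟫_ℝ = ⟪curl V y, gradient (fun z => ⟪V z, e⟫_ℝ) y⟫_ℝ := by
  rw [real_inner_comm (gradient (fun z => ⟪V z, e⟫_ℝ) y),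
    Literature.Analysis.FluidPDE.inner_gradient_left (fun z => ⟪V z, e⟫_ℝ) y (curl V y),
    fderiv_inner_apply ℝ hV (differentiableAt_const e), fderiv_const_apply]
  simp

/-- **Divergence representation**: for a `C¹` field `V` bounded by `M`, the component
`⟪curl V, e⟫` is the divergence of the `C¹` field `V × e`, bounded by `M ‖e‖`
(`divergence_cross_holds` with the constant field `e`, whose curl vanishes; `norm_cross_le`). -/
theorem noStretch_div_rep {V : EuclideanSpace ℝ (Fin 3) → EuclideanSpace ℝ (Fin 3)}
    (hV : ContDiff ℝ 1 V) {M : ℝ} (hM : ∀ y, ‖V y‖ ≤ M) (e : EuclideanSpace ℝ (Fin 3)) :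
    ∃ F : EuclideanSpace ℝ (Fin 3) → EuclideanSpace ℝ (Fin 3),
      ContDiff ℝ 1 F ∧ (∀ y, ‖F y‖ ≤ M * ‖e‖) ∧
        ∀ y, ⟪curl V y, e⟫_ℝ = VectorCalculus.divergence F y := by
  refine ⟨fun y => cross (V y) e, (crossCLM.contDiff.comp hV).clm_apply contDiff_const,
    fun y => ?_, fun y => ?_⟩
  · exact (norm_cross_le _ _).trans (mul_le_mul_of_nonneg_right (hM y) (norm_nonneg e))
  · have h := divergence_cross_holds V (fun _ => e) y ((hV.differentiable one_ne_zero) y)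
      (differentiableAt_const e)
    have h0 : curl (fun _ : EuclideanSpace ℝ (Fin 3) => e) y = 0 :=
      curl_eq_zero_of_fderiv_eq_zero (fderiv_const_apply e)
    simp only [h0, inner_zero_right, sub_zero] at h
    rw [h, real_inner_comm]

/-! ## The §4 representative: identification, bounds, the equation for `θ` -/

/-- **Identification of the vorticities at every `t < 0`.** If `v` is jointly smooth on
`(-∞, 0) × ℝ³`, `U(t)` is smooth with derivatives of order `≥ 1` Lipschitz in `t`, and
`v(t) = U(t) + b(t)` a.e. in `x` for a.e. `t < 0`, then `v(t) = U(t) + b(t)` everywhere for a.e.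
`t < 0` (both sides are continuous in `x`, `Continuous.ae_eq_iff_eq`) and `curl v(t) = curl U(t)`
for **every** `t < 0` (both sides are continuous in `t`, `eq_of_ae_restrict_Iio_of_continuousOn`). -/
theorem noStretch_curl_eq {v U : ℝ → EuclideanSpace ℝ (Fin 3) → EuclideanSpace ℝ (Fin 3)}
    {b : ℝ → EuclideanSpace ℝ (Fin 3)} (hv : IsSmoothSpaceTimeOn (Iio 0) v)
    (hsmooth : ∀ t < 0, ContDiff ℝ ∞ (U t)) {L : ℕ → ℝ}
    (hL : ∀ k : ℕ, 1 ≤ k → ∀ s < 0, ∀ t < 0, ∀ x,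
      ‖iteratedFDeriv ℝ k (U t) x - iteratedFDeriv ℝ k (U s) x‖ ≤ L k * |t - s|)
    (hae : ∀ᵐ t ∂((volume : Measure ℝ).restrict (Iio 0)), v t =ᵐ[volume] fun x => U t x + b t) :
    (∀ᵐ t ∂((volume : Measure ℝ).restrict (Iio 0)), v t = fun x => U t x + b t) ∧
      ∀ t < 0, curl (v t) = curl (U t) := by
  have hS : UniqueDiffOn ℝ (Iio (0 : ℝ)) := isOpen_Iio.uniqueDiffOn
  have hgood : ∀ᵐ t ∂((volume : Measure ℝ).restrict (Iio 0)), v t = fun x => U t x + b t := by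
    filter_upwards [hae, ae_restrict_mem measurableSet_Iio] with t ht htneg
    have htneg : t < 0 := htneg
    exact (Continuous.ae_eq_iff_eq volume (hv.contDiff_slice htneg).continuous
      ((hsmooth t htneg).continuous.add continuous_const)).1 ht
  refine ⟨hgood, fun t ht => funext fun x => ?_⟩
  have hω : IsSmoothSpaceTimeOn (Iio 0) (fun s y => curl (v s) y) :=
    (hv.fderiv_slice hS).clm_comp curlCLM
  have hc1 : ContinuousOn (fun s => curl (v s) x) (Iio 0) := fun s hs =>
    (hω.differentiableWithinAt_time hs x).continuousWithinAt
  have hc2 : ContinuousOn (fun s => curl (U s) x) (Iio 0) :=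
    continuousOn_curl_of_lipschitz_succ hL x
  have h := eq_of_ae_restrict_Iio_of_continuousOn (c := (0 : EuclideanSpace ℝ (Fin 3)))
    (hc1.sub hc2) ?_ ht
  · exact sub_eq_zero.1 h
  · filter_upwards [hgood] with s hs
    show curl (v s) x - curl (U s) x = 0
    rw [hs, curl_add_const_eq, sub_self]

/-- **Bounds for `θ_U = ⟪curl U, e⟫`, `Dθ_U`, `Δθ_U`** from the uniform bounds on `D¹U`, `D²U`,
`D³U` of the §4 fact: `θ_U = Λ ∘ DU` for the fixed linear map `Λ = ⟪curlCLM ·, e⟫`, so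
`‖Dⁿθ_U‖ ≤ ‖Λ‖ ‖Dⁿ⁺¹U‖` (`norm_iteratedFDeriv_clm_apply_fderiv_le`) and `|Δθ_U| ≤ 3 ‖D²θ_U‖`
(`norm_iteratedFDeriv_laplacian_le`). -/
theorem noStretch_family_bounds {U : ℝ → EuclideanSpace ℝ (Fin 3) → EuclideanSpace ℝ (Fin 3)}
    (hsmooth : ∀ t < 0, ContDiff ℝ ∞ (U t)) {C : ℕ → ℝ}
    (hC : ∀ k : ℕ, ∀ t < 0, ∀ x, ‖iteratedFDeriv ℝ k (U t) x‖ ≤ C k) (e : EuclideanSpace ℝ (Fin 3)) :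
    ∃ K₀ K₁ K₂ : ℝ, ∀ t < 0, ∀ y,
      |⟪curl (U t) y, e⟫_ℝ| ≤ K₀ ∧ ‖fderiv ℝ (fun z => ⟪curl (U t) z, e⟫_ℝ) y‖ ≤ K₁ ∧
        |(Δ (fun z => ⟪curl (U t) z, e⟫_ℝ)) y| ≤ K₂ := by
  obtain ⟨Λ, hΛ⟩ : ∃ Λ : (EuclideanSpace ℝ (Fin 3) →L[ℝ] EuclideanSpace ℝ (Fin 3)) →L[ℝ] ℝ,
      ∀ V : EuclideanSpace ℝ (Fin 3) → EuclideanSpace ℝ (Fin 3),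
        (fun z => ⟪curl V z, e⟫_ℝ) = fun z => Λ (fderiv ℝ V z) :=
    ⟨((innerSL ℝ).flip e).comp curlCLM, fun V => rfl⟩
  refine ⟨‖Λ‖ * C 1, ‖Λ‖ * C 2, Module.finrank ℝ (EuclideanSpace ℝ (Fin 3)) * (‖Λ‖ * C 3),
    fun t ht y => ⟨?_, ?_, ?_⟩⟩
  · have h := norm_iteratedFDeriv_clm_apply_fderiv_le Λ (hsmooth t ht) 0 y
    rw [norm_iteratedFDeriv_zero, Real.norm_eq_abs] at h
    have h1 := congrFun (hΛ (U t)) y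
    rw [h1]
    exact h.trans (mul_le_mul_of_nonneg_left (hC 1 t ht y) (norm_nonneg Λ))
  · rw [hΛ (U t), norm_fderiv_eq_norm_iteratedFDeriv_one]
    exact (norm_iteratedFDeriv_clm_apply_fderiv_le Λ (hsmooth t ht) 1 y).trans
      (mul_le_mul_of_nonneg_left (hC 2 t ht y) (norm_nonneg Λ))
  · have hθ : ContDiff ℝ ∞ (fun z => Λ (fderiv ℝ (U t) z)) :=
      Λ.contDiff.comp ((hsmooth t ht).fderiv_right (m := ∞) le_rfl)
    have h2 := norm_iteratedFDeriv_laplacian_le hθ 0 y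
    rw [norm_iteratedFDeriv_zero, Real.norm_eq_abs] at h2
    rw [hΛ (U t)]
    refine h2.trans (mul_le_mul_of_nonneg_left ?_ (Nat.cast_nonneg _))
    exact (norm_iteratedFDeriv_clm_apply_fderiv_le Λ (hsmooth t ht) 2 y).trans
      (mul_le_mul_of_nonneg_left (hC 3 t ht y) (norm_nonneg Λ))

/-- **The drift–heat equation for `θ = ⟪curl v, e⟫` without stretching.** Dot the integrated
vorticity equation of the §4 representative,
`ω(t) − ω(s) = ∫ₛᵗ (Δω − Dω[U + b] + DU[ω]) dτ` (`ω = curl U = curl v`), with the fixed vector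
`e`: at a.e. `τ < 0` one has `v(τ) = U(τ) + b(τ)`, so `DU(τ) = Dv(τ)` and the stretching
integrand is `⟪Dv ω, e⟫ = ω·∇⟪v, e⟫ = 0` (`noStretch_inner_stretch_eq` and the hypothesis);
the other two integrands are `Δθ` and `Dθ[U + b]` (`noStretch_laplacian_inner_curl`,
`noStretch_fderiv_inner_curl`). -/
theorem noStretch_equation {v U : ℝ → EuclideanSpace ℝ (Fin 3) → EuclideanSpace ℝ (Fin 3)}
    {b : ℝ → EuclideanSpace ℝ (Fin 3)} (hvs : ∀ t < 0, ContDiff ℝ ∞ (v t))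
    (hsmooth : ∀ t < 0, ContDiff ℝ ∞ (U t)) {C : ℕ → ℝ}
    (hC : ∀ k : ℕ, ∀ t < 0, ∀ x, ‖iteratedFDeriv ℝ k (U t) x‖ ≤ C k) {L : ℕ → ℝ}
    (hL : ∀ k : ℕ, 1 ≤ k → ∀ s < 0, ∀ t < 0, ∀ x,
      ‖iteratedFDeriv ℝ k (U t) x - iteratedFDeriv ℝ k (U s) x‖ ≤ L k * |t - s|)
    (hUm : Measurable (uncurry U)) (hbm : Measurable b) {Cb : ℝ} (hCb : ∀ t, ‖b t‖ ≤ Cb)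
    (hvort : ∀ x, ∀ s t : ℝ, s ≤ t → t < 0 →
      curl (U t) x - curl (U s) x =
        ∫ τ in s..t, ((Δ (curl (U τ))) x - fderiv ℝ (curl (U τ)) x (U τ x + b τ) +
          fderiv ℝ (U τ) x (curl (U τ) x)))
    (hgood : ∀ᵐ t ∂((volume : Measure ℝ).restrict (Iio 0)), v t = fun x => U t x + b t)
    (hcurl : ∀ t < 0, curl (v t) = curl (U t)) (e : EuclideanSpace ℝ (Fin 3))
    (hns : ∀ t < 0, ∀ x : EuclideanSpace ℝ (Fin 3),
      ⟪curl (v t) x, gradient (fun y => ⟪v t y, e⟫_ℝ) x⟫_ℝ = 0)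
    (y : EuclideanSpace ℝ (Fin 3)) {s t : ℝ} (hst : s ≤ t) (ht : t < 0) :
    ⟪curl (v t) y, e⟫_ℝ - ⟪curl (v s) y, e⟫_ℝ =
      ∫ τ in s..t, ((Δ (fun z => ⟪curl (v τ) z, e⟫_ℝ)) y -
        fderiv ℝ (fun z => ⟪curl (v τ) z, e⟫_ℝ) y (U τ y + b τ)) := by
  have hint := vorticity_integrand_intervalIntegrable hsmooth hC hL hUm hbm hCb y hst ht
  have hs : s < 0 := hst.trans_lt ht
  rw [hcurl t ht, hcurl s hs, ← inner_sub_left, hvort y s t hst ht,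
    show ∀ u : EuclideanSpace ℝ (Fin 3), ⟪u, e⟫_ℝ = ((innerSL ℝ).flip e) u from fun u => rfl,
    ← ((innerSL ℝ).flip e).intervalIntegral_comp_comm hint]
  refine intervalIntegral.integral_congr_ae ?_
  have hgood' := (ae_restrict_iff' (measurableSet_Iio (a := (0 : ℝ)))).1 hgood
  filter_upwards [hgood'] with τ hτ hτI
  rw [uIoc_of_le hst] at hτI
  have hτ0 : τ < 0 := hτI.2.trans_lt ht
  have hvU : v τ = fun x => U τ x + b τ := hτ hτ0
  have hDU : fderiv ℝ (U τ) y = fderiv ℝ (v τ) y := by rw [hvU, fderiv_add_const]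
  have hd : DifferentiableAt ℝ (v τ) y := ((hvs τ hτ0).differentiable (by simp)) y
  have hv3 : ContDiff ℝ 3 (v τ) := (hvs τ hτ0).of_le (by norm_cast)
  have hv2 : ContDiff ℝ 2 (v τ) := (hvs τ hτ0).of_le (by norm_cast)
  rw [ContinuousLinearMap.flip_apply, innerSL_apply_apply, inner_add_left, inner_sub_left,
    ← hcurl τ hτ0, hDU, noStretch_inner_stretch_eq hd e, hns τ hτ0 y, add_zero,
    noStretch_laplacian_inner_curl hv3, noStretch_fderiv_inner_curl hv2]

/-! ## The registered stub -/

/-- **No-stretch data** (the Navier–Stokes half of hull (E)): for a bounded ancient mild solution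
(classical on `(-∞,0)`) and a fixed vector `e` with `ω·∇⟪v,e⟫ ≡ 0`, the component
`θ = ⟪ω, e⟫` is in the class of KNSS Lemma 2.1 with a bounded measurable drift — bounds on `θ`,
`Dθ`, `Δθ` and their joint continuity from the §4 regularity of bounded ancient solutions
(`KNSS2009_regularity_boundedWeak_ancient_holds`: smooth representative `U` with `v(t) = U(t) + b(t)`,
all derivatives bounded and time-Lipschitz, the integrated vorticity equation with drift `U + b`),
the stretching term `⟪DU ω, e⟫ = ω·∇⟪v,e⟫` being zero — and every slice is the divergence of the
bounded `C¹` field `v × e` (`div (v × e) = ⟪e, curl v⟫`, `divergence_cross_holds`). -/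
theorem stub_noStretchData :
    ∀ (v : ℝ → (EuclideanSpace ℝ (Fin 3)) → (EuclideanSpace ℝ (Fin 3)))
      (q : ℝ → (EuclideanSpace ℝ (Fin 3)) → ℝ),
      IsBoundedAncientMildSolution 1 v → IsClassicalNSSolutionOn (Set.Iio 0) 1 0 v q →
      ∀ (e : EuclideanSpace ℝ (Fin 3)),
      (∀ t < 0, ∀ x : EuclideanSpace ℝ (Fin 3),
          ⟪curl (v t) x, gradient (fun y => ⟪v t y, e⟫_ℝ) x⟫_ℝ = 0) →
      ∃ (a : ℝ → (EuclideanSpace ℝ (Fin 3)) → (EuclideanSpace ℝ (Fin 3))) (A K : ℝ),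
        Measurable (uncurry a) ∧ (∀ t < 0, ∀ y, ‖a t y‖ ≤ A) ∧
        (∃ C : ℝ, ∀ t < 0, ∀ y, |⟪curl (v t) y, e⟫_ℝ| ≤ C) ∧
        (∀ t < 0, ContDiff ℝ 2 (fun y => ⟪curl (v t) y, e⟫_ℝ)) ∧
        (∃ C : ℝ, ∀ t < 0, ∀ y, ‖fderiv ℝ (fun y => ⟪curl (v t) y, e⟫_ℝ) y‖ ≤ C ∧
          |(Δ (fun y => ⟪curl (v t) y, e⟫_ℝ)) y| ≤ C) ∧
        ContinuousOn (fun p : ℝ × (EuclideanSpace ℝ (Fin 3)) =>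
          fderiv ℝ (fun y => ⟪curl (v p.1) y, e⟫_ℝ) p.2) (Set.Iio 0 ×ˢ Set.univ) ∧
        ContinuousOn (fun p : ℝ × (EuclideanSpace ℝ (Fin 3)) =>
          (Δ (fun y => ⟪curl (v p.1) y, e⟫_ℝ)) p.2) (Set.Iio 0 ×ˢ Set.univ) ∧
        (∀ y, ∀ s t : ℝ, s ≤ t → t < 0 →
          ⟪curl (v t) y, e⟫_ℝ - ⟪curl (v s) y, e⟫_ℝ =
            ∫ τ in s..t, ((Δ (fun y => ⟪curl (v τ) y, e⟫_ℝ)) y -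
              fderiv ℝ (fun y => ⟪curl (v τ) y, e⟫_ℝ) y (a τ y))) ∧
        (∀ t < 0, ∃ F : (EuclideanSpace ℝ (Fin 3)) → (EuclideanSpace ℝ (Fin 3)),
          ContDiff ℝ 1 F ∧ (∀ y, ‖F y‖ ≤ K) ∧ ∀ y, ⟪curl (v t) y, e⟫_ℝ = VectorCalculus.divergence F y) := by
  intro v q hanc hcl e hns
  -- joint smoothness of `v`, `ω = curl v`, `θ = ⟪ω, e⟫` on `(-∞, 0) × ℝ³`
  have hS : UniqueDiffOn ℝ (Iio (0 : ℝ)) := isOpen_Iio.uniqueDiffOn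
  have hv : IsSmoothSpaceTimeOn (Iio 0) v := hcl.smooth_velocity
  have hvs : ∀ t < 0, ContDiff ℝ ∞ (v t) := fun t ht => hcl.contDiff_velocity ht
  have hω : IsSmoothSpaceTimeOn (Iio 0) (fun s y => curl (v s) y) :=
    (hv.fderiv_slice hS).clm_comp curlCLM
  have hθ : IsSmoothSpaceTimeOn (Iio 0) (fun s y => ⟪curl (v s) y, e⟫_ℝ) :=
    hω.inner (isSmoothSpaceTimeOn_const_time (φ := fun _ => e) contDiff_const _)
  -- `v` is a bounded weak solution on `ℝ³ × (-∞, 0)`; the §4 representative `U + b`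
  have hmeas : AEStronglyMeasurable (uncurry v)
      ((volume : Measure (ℝ × EuclideanSpace ℝ (Fin 3))).restrict (Iio 0 ×ˢ univ)) :=
    hv.continuousOn.aestronglyMeasurable (measurableSet_Iio.prod MeasurableSet.univ)
  have hsl : ∀ t < 0, AEStronglyMeasurable (v t) volume := fun t ht =>
    (hvs t ht).continuous.aestronglyMeasurable
  obtain ⟨U, b, hbm, ⟨Cb, hCb⟩, hUm, hae, hsmooth, -, hbd, hlip, hvort⟩ :=
    KNSS2009_regularity_boundedWeak_ancient_holds
      (hanc.isBoundedWeakNSSolutionOn one_pos hmeas hsl)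
  choose C hC using hbd
  choose! L hL using hlip
  obtain ⟨M, hM⟩ := hanc.2
  obtain ⟨hgood, hcurl⟩ := noStretch_curl_eq hv hsmooth hL hae
  obtain ⟨K₀, K₁, K₂, hK⟩ := noStretch_family_bounds hsmooth hC e
  refine ⟨fun τ y => U τ y + b τ, C 0 + Cb, M * ‖e‖, ?_, ?_, ⟨K₀, fun t ht y => ?_⟩,
    fun t ht => ?_, ⟨max K₁ K₂, fun t ht y => ?_⟩, ?_, ?_, fun y s t hst ht => ?_, fun t ht => ?_⟩
  · -- the drift `U + b` is jointly measurable
    have h : uncurry (fun τ y => U τ y + b τ) =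
        fun p : ℝ × EuclideanSpace ℝ (Fin 3) => uncurry U p + b p.1 := by
      funext p; rfl
    rw [h]
    exact hUm.add (hbm.comp measurable_fst)
  · -- and bounded
    intro t ht y
    have h0 := hC 0 t ht y
    rw [norm_iteratedFDeriv_zero] at h0
    exact (norm_add_le _ _).trans (add_le_add h0 (hCb t))
  · rw [hcurl t ht]
    exact (hK t ht y).1
  · exact (hθ.contDiff_slice ht).of_le (by norm_cast)
  · rw [hcurl t ht]
    exact ⟨(hK t ht y).2.1.trans (le_max_left _ _), (hK t ht y).2.2.trans (le_max_right _ _)⟩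
  · exact (hθ.fderiv_slice hS).continuousOn
  · exact (hθ.laplacian hS).continuousOn
  · exact noStretch_equation hvs hsmooth hC hL hUm hbm hCb hvort hgood hcurl e hns y hst ht
  · exact noStretch_div_rep ((hvs t ht).of_le (by norm_cast)) (fun y => hM t ht y) e

end Summit.NavierStokesRegularity.NavierStokesRegularity.Theorems.IsobaricLinesLiouville.FluxSurfacePersistence

end
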